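import Summits.BirchSwinnertonDyer.Rank1Residual.Additive.GordThreeCycLowerCore
import Summits.BirchSwinnertonDyer.Rank1Residual.Additive.CycLeadingTermDvdIff
import Summits.BirchSwinnertonDyer.Rank1Residual.Additive.X4SharpThreeKimConjectureEndState
import Summits.BirchSwinnertonDyer.Rank1Residual.Additive.X4SharpThreeAssembly
import Literature.NumberTheory.EllipticCurves.ZywinaCMImageProofs
import HarnessLib

/-!
# U3 / ROUTE-BK (Beilinson–Kato lens at `p = 3`), Part B: companion-form residual transport of
# `[Kato's main conjecture ∧ μ = 0]` on the SPLIT sub-locus of N11 — the typed chain, its cruxes as named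
# conjecture binders over an INTERFACE of the form-level objects, and the sorry-free compositions into
# `Typed.MissingLowerBoundAt W 3` (cell `bsd-uniform`, track U3, seat u3-p2; route file `HOME/u3/ROUTE-BK.md`,
# planner skeleton `HOME/u3/ROUTE-BK-skeleton.lean`, seat u3-idea-bk)

HONEST FRAMING (cell `bsd-uniform`, run/shared/lean/pub/bsd-uniform/, verbatim in every file): the goal
of the cell is a CONDUCTOR-FREE BSD formula in analytic rank `≤ 1` via UNIFORM CLASS THEOREMS whose
hypotheses are class predicates and PRINTED theorems. THIS FILE PROVES NO SUCH THEOREM. What it proves is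
a COMPOSITION: on the sub-class S-SPLIT of N11 (`ClassX4 W 3`, analytic rank `0`, `ρ̄_{E,3}` onto,
potentially ORDINARY at `3` — Delbourgo's type (G) `TypeGOrd W 3` or potentially multiplicative
`PotMult W 3` — and `E[3]|_{G_{ℚ₃}}` SPLIT), the LOWER half `ord₃ #Ш_an ≤ ord₃ #Ш` follows from SIX named
inputs, each an explicit binder and NONE asserted: K1 (residual transport of `[KMC ∧ μ = 0]` at `3`
from a level-prime-to-3 ordinary companion form to `f_E` — the ONE step NOT IN PRINT: its content is a
mod-3 multiplicity-one statement at level `9M`, Kim–Lee–Ponsinet's mechanism moved across the level-3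
structure), K2/K2′ (a companion exists on the split locus, with the Skinner–Urban side conditions —
Serre's conjecture as proved, companion forms; class-predicate shaped), K2″ (Skinner–Urban 2014 Thm. 1 at
`p = 3` ⇒ Kato's IMC for the companion — PUB with the tree flag `SU14-12.3.6-mu@nonsplit@3`), K3 (`μ = 0`
for the companion — Greenberg's conjecture, ONE bit per residual class: a CLASS-INDEXED certificate, not
uniform), K4 (descent from Kato's IMC for `f_E` to the lower half: K4a to the `T = 0` Eisenstein
divisibility `CycLowerLeadingTermAt W 3` of the IW lens, or K4b directly). The form-level OBJECTS the tree
lacks (newforms with a prime above `3`, Kato's IMC in fine-Selmer form = O6's definition request D-O6-2,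
its `μ`-invariant, the companion relation, the split predicate) are an INTERFACE (`ResidualTransportKit`,
D-0019: interface ≠ construction; an instance over tree vocabulary is a separate task); the existence of a
companion is a SEPARATE statement (K2), never smuggled into the interface. Residue (class-predicate shaped,
named in HOME/RESIDUE.md §U3): NON-SPLIT rows, (G)-supersingular `e = 2` rows, WILD rows
(`e ∈ {3,4,6,12}`), EXOTIC-9 (Elkies 3-adic image), RAM (no `q ‖ N_E` with `3 ∤ ord_q Δ_E`), COEF, MU (the
`μ`-bit), ANOM/TAM3 for the K4a socket only, MANIN-3 for K4a. Nothing is booked; no density moves; no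
summit claim; every PRE input (Kim–Pollack 2025) carries the flag `Kim2025-preprint`.

WHY THIS IS NOVEL (one sentence, ROUTE-BK §5): the route changes the residual AVATAR instead of the
cyclotomic branch — on the split locus at `3` the additive curve's own mod-3 representation has a
3-ordinary weight-2 companion of level prime to `3`, for which Skinner–Urban at `p = 3` is a theorem, and a
Kim–Lee–Ponsinet-type mod-3 transport of `[Kato IMC ∧ μ = 0]` across that congruence — whose one
unprinted input is mod-3 multiplicity one at level `9M` for a non-ordinary locally-split `𝔪` — delivers
KMC₃(f_E) and hence the lower half, with no 3-adic L-function, Hida family or ordinarity for `E`.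

EVIDENCE (census, u3-idea-bk 2026-08-22T19:24Z, `HOME/bsd-uniform-u3-idea-bk/census/SPLIT-CENSUS-LOWER3.tsv`,
sha16 69368ba2ef6fa9bd; EVIDENCE only, no coverage claim): on the 7 394 LOWER@3 content rows of N11
(`3 ∣ #Ш_an`) the split predicate holds on (G-ord) 187 / 667 = 28.0 % and on (M) 281 / 3 846 = 7.3 % — the
sub-class S-SPLIT is non-empty and proper. Route file of record `HOME/u3/ROUTE-BK.md` sha16 e27784eda730efe2,
skeleton `HOME/u3/ROUTE-BK-skeleton.lean` sha16 1e4b6c5b2a8456fb (this file = that skeleton made tree-shaped: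
same binders, `@[conjecture]` tags, cite records, the (M)@3 twin, the CM discharge, the K4b-from-bridge
compositions and the concrete D3 predicate added).

Sources AS PRINTED (locators = `lit read` page files; u3-lit `HOME/u3/WHY-NOT-3.md` v1.2 is the sheet of
record): C.-H. Kim, J. Lee, G. Ponsinet, arXiv:1909.01764 Thm. 2.1 [p0006 L8–30; standing "p odd …
newform with (N,p) = 1" p0004 L19; "S_k(ρ̄) … p does not divide the levels" p0006 L5–6] (PRE);
C. Skinner, E. Urban, Invent. Math. 195 (2014) Thm. 1 = Thm. 3.6.4 [p0002 L35–45, p0043 L7–20; "Let p be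
an odd prime" p0001 L7] — tree `SkinnerUrban2014.thm1_charIdeal_eq_padicLFunction_rational`, flag
`SU14-12.3.6-mu@nonsplit@3`; K. Kato, Astérisque 295 (2004) Thm. 12.5, Conj. 12.10 (p. 224), Thm. 14.5 (3),
Prop. 14.16 (2); C.-H. Kim, Amer. J. Math. 148 (2026) Conj. 1.3, Thm. 1.10/1.11, Conj. 1.10 [arXiv:2203.12159
p0005 L52–60, p0008 L25–62]; C.-H. Kim (app. R. Pollack), arXiv:2505.09121v1 Thm. 1.1, Cor. 1.7, Thm. 3.18,
Cor. 3.13–3.14 (PRE; tree `Kim2025.thm11_kimShaLength_of_integralPeriod_OPEN`); R. Sakamoto, JTNB 36 (2024)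
Thm. 4.4 (PUB; tree `Sakamoto2024.*`); D. Delbourgo, Compositio 113 (1998) Prop. 4, J. Number Theory 95 (2002)
Thm. (A)(B) (tree `Delbourgo1998.*`, `Delbourgo2002.mainTheorem_three`); R. Greenberg, LNM 1716 (1999)
Conj. 1.11 (μ = 0); B. Edixhoven, Invent. Math. 109 (1992) Thm. 4.5 / B. Gross, Duke Math. J. 61 (1990) /
R. Coleman, J. Voloch, Invent. Math. 110 (1992) (companion forms; weight part of Serre's conjecture);
D. Zywina, arXiv:1508.07663 (tree `WeierstrassCurve.not_hasSurjectiveModNGaloisRep_of_hasCM`); R. L. Miller,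
LMS J. Comput. Math. 14 (2011) Def. 1.1 (`Typed.MissingLowerBoundAt`).
-/

noncomputable section

open scoped Classical

open WeierstrassCurve Literature.NumberTheory.EllipticCurves
  Literature.NumberTheory.EllipticCurves.ModularForms
  Literature.NumberTheory.EllipticCurves.Rank1Residual
  Literature.NumberTheory.EllipticCurves.Rank1Residual.Typed
  Summit.BirchSwinnertonDyer.Rank1Residual
  Summit.BirchSwinnertonDyer.Rank1Residual.Additive

namespace Summit.BirchSwinnertonDyer.Uniform.U3.RouteBK

/-! ### §1 The interface of the form-level objects (definition requests D1–D3 of ROUTE-BK; D-0019) -/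

/-- **INTERFACE of the form-level objects of ROUTE-BK Part B** (definition requests D1–D3; nothing
asserted — every field is data or a predicate, no field is a proof, and the EXISTENCE of a companion is a
separate statement `CompanionExistsOfSplit`, never a field). Intended instance: `Form` = pairs
(weight-2 newform with trivial character, prime `λ ∣ 3` of its coefficient field) as in
`SkinnerUrban2014.thm1_…`; `KMC` = Kato's main conjecture in fine-Selmer form (Kato Conj. 12.10 = Kim
Conj. 1.3; O6 request D-O6-2); `MuZero` = its `μ`-invariant vanishes; `IsCompanion W g` = `g` of level
prime to `3`, 3-ordinary, `ρ̄_{g,λ} ≅ E[3]`; `SplitAtThree W` = `E[3]|_{G_{ℚ₃}}` split (cf. the concrete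
`SplitModThreeAtThree` below); `SUHyp g` = Skinner–Urban's (ram) + `SL₂(ℤ₃) ⊆ im ρ_{g,λ}`.
[cite: Kato2004Asterisque, Conj. 12.10 (p. 224)] [cite: Kim2022StructureSelmer, Conj. 1.3 (arXiv v4 p0005 L52–60)]
[cite: SkinnerUrban2014, Thm. 1 (p. 2) = Thm. 3.6.4 (p. 43)] -/
structure ResidualTransportKit where
  /-- Carrier: pairs `(g, λ)` — a weight-2 newform with trivial character and a prime `λ ∣ 3` of its
  coefficient field. -/
  Form : Type
  /-- `f_E` with its unique prime above `3`. -/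
  formOf : ∀ (W : WeierstrassCurve ℚ) [W.IsElliptic], Form
  /-- D2 = O6's D-O6-2: Kato's main conjecture for `(g, λ)` in fine-Selmer form,
  `char_Λ(H¹_Iw(ℚ,T_g)/Λ z(g)) = char_Λ(Sel₀(ℚ_∞, A_g)^∨)` (EQUALITY). -/
  KMC : Form → Prop
  /-- `μ(Sel₀(ℚ_∞, A_g)^∨) = 0`. -/
  MuZero : Form → Prop
  /-- D1: `g` is a COMPANION AVATAR of `E` at `3`: level prime to `3`, `a₃(g)` a `λ`-unit, `ρ̄_{g,λ} ≅ E[3]`. -/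
  IsCompanion : ∀ (W : WeierstrassCurve ℚ) [W.IsElliptic], Form → Prop
  /-- D3: the SPLIT predicate `E[3]|_{G_{ℚ₃}} ≅ u ⊕ ω̄u⁻¹`. -/
  SplitAtThree : ∀ (W : WeierstrassCurve ℚ) [W.IsElliptic], Prop
  /-- Skinner–Urban's side conditions for `(g, λ)` at `p = 3` beyond (irr): (ram) and `SL₂(ℤ₃) ⊆ im ρ_{g,λ}`. -/
  SUHyp : Form → Prop

/-- **D3, concrete form (a class predicate over the tree's vocabulary; not wired into the interface):**
`E[3]|_{G_{ℚ₃}}` is SPLIT, i.e. the geometric 3-torsion of the base change `E/ℚ₃` contains two DISTINCT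
`Γ_{ℚ₃}`-stable subgroups of order `3` (two stable lines = semisimple reducible). Decidable from a minimal
model (roots of the 3-division polynomial over `ℚ₃`; Tate parameter a cube on the (M) rows — ROUTE-BK D3);
an instance of `ResidualTransportKit.SplitAtThree` is meant to be this predicate. A predicate; nothing
asserted. [cite: SilvermanAEC2009, III.§7 and VII.§§2–3 (reduction of torsion)] -/
def SplitModThreeAtThree (W : WeierstrassCurve ℚ) : Prop :=
  ∃ Φ₁ Φ₂ : AddSubgroup (geomTorsion (W.baseChange ℚ_[3]) 3),
    Φ₁ ≠ Φ₂ ∧ Nat.card Φ₁ = 3 ∧ Nat.card Φ₂ = 3 ∧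
    (∀ σ : Field.absoluteGaloisGroup ℚ_[3], ∀ P ∈ Φ₁, σ • P ∈ Φ₁) ∧
    (∀ σ : Field.absoluteGaloisGroup ℚ_[3], ∀ P ∈ Φ₂, σ • P ∈ Φ₂)

variable (K : ResidualTransportKit)

/-! ### §2 The cruxes of ROUTE-BK Part B as named conjecture binders (K1–K4; nothing asserted) -/

/-- **K1 (crux, THE non-printed step): residual transport of `[KMC ∧ μ = 0]` at `3` from a companion to
`f_E`.** For `g` a companion avatar of `E` (level prime to `3`, ordinary, `ρ̄_g ≅ E[3]`):
`KMC(g) ∧ μ(g) = 0 ⟹ KMC(f_E) ∧ μ(f_E) = 0`. Kim–Lee–Ponsinet Thm. 2.1 (2)(3) prove this shape among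
forms of level PRIME TO `p` on one branch; the target `f_E` has `9 ∣ N`, `U₃ f_E = 0`, so the step is NOT
IN PRINT (sub-steps K1a mod-3 multiplicity one at level `9M` for the non-ordinary locally-split `𝔪`; K1b
Ihara at `ℓ ≠ 3`; K1c the `H²` side, level-free). Honest odds (ROUTE-BK): true ≈ 0.7, provable from
existing print ≈ 0.25. A conjecture shell over the interface; nothing asserted.
[cite: Kim2019KatoInvariants, Thm. 2.1 (arXiv:1909.01764 p0006 L8–30) and §1.2 standing "(N,p) = 1" (p0004 L19)] -/
@[conjecture] def ResidualTransportAtThree : Prop :=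
  ∀ (W : WeierstrassCurve ℚ) [W.IsElliptic] (g : K.Form),
    K.IsCompanion W g → K.KMC g ∧ K.MuZero g → K.KMC (K.formOf W) ∧ K.MuZero (K.formOf W)

/-- **K2 (support): a companion avatar exists on the split locus.** Serre's recipe gives `k(ρ̄) = 2`,
`3 ∤ N(ρ̄)` exactly when `E[3]|_{D₃}` is split; `ρ̄ = E[3]` is modular and absolutely irreducible with image
`GL₂(𝔽₃)`, so the weight/level part of Serre's conjecture (Ribet; Edixhoven 1992 Thm. 4.5; companion forms
Gross 1990 / Coleman–Voloch 1992) yields a weight-2 newform of level prime to `3` with `ρ̄_g ≅ E[3]`,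
automatically 3-ordinary. PUB modulo typing of D1 (u3-lit to pin page-exact at `p = 3`). Nothing asserted.
[cite: Edixhoven1992, Thm. 4.5] [cite: Gross1990, companion-form theorem] [cite: ColemanVoloch1992, main theorem] -/
@[conjecture] def CompanionExistsOfSplit [Fact (Nat.Prime 3)] : Prop :=
  ∀ (W : WeierstrassCurve ℚ) [W.IsElliptic],
    ClassX4 W 3 → W.HasSurjectiveModNGaloisRep 3 → (TypeGOrd W 3 ∨ PotMult W 3) → K.SplitAtThree W →
      ∃ g : K.Form, K.IsCompanion W g

/-- **K2′ (certificate-shaped side conditions, class-indexed):** some companion of `E` satisfies (ram) and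
the `SL₂(ℤ₃)`-image condition. (ram) holds for every companion iff `∃ q ≠ 3, q ‖ N_E, 3 ∤ ord_q Δ_E` (a
class predicate; residue RAM); the 3-adic image of `g` is a per-companion check (residue COEF when the
companion is not `ℤ₃`-rational at `λ`). Nothing asserted. [cite: SkinnerUrban2014, Thm. 1 (p. 2), hypotheses (ram) and "image contains SL₂(ℤ_p)"] -/
@[conjecture] def CompanionSideConditions [Fact (Nat.Prime 3)] : Prop :=
  ∀ (W : WeierstrassCurve ℚ) [W.IsElliptic],
    ClassX4 W 3 → W.HasSurjectiveModNGaloisRep 3 → (TypeGOrd W 3 ∨ PotMult W 3) → K.SplitAtThree W →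
      (∃ g : K.Form, K.IsCompanion W g) → ∃ g : K.Form, K.IsCompanion W g ∧ K.SUHyp g

/-- **K2″ (PUB\* fact shape): Skinner–Urban 2014 Thm. 1 on the `ω⁰` branch at `p = 3` (tree typing
`SkinnerUrban2014.thm1_charIdeal_eq_padicLFunction_rational`, binder `3 ≤ p`; ACTIVE-PRINT-GAP flag
`SU14-12.3.6-mu@nonsplit@3`) + Kato Thm. 12.5 + Kato §17.13 comparison ⟹ Kato's main conjecture for a
3-ordinary, level-prime-to-3 newform with (irr), (ram), big image.** Over the interface; nothing asserted.
[cite: SkinnerUrban2014, Thm. 1 (p. 2) = Thm. 3.6.4 (p. 43)] [cite: Kato2004Asterisque, Thm. 12.5 (4) (p. 222) and 17.13 (pp. 279–280)] -/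
@[conjecture] def CompanionKMCOfSU : Prop :=
  ∀ g : K.Form, K.SUHyp g → K.KMC g

/-- **K3 (crux, class-indexed certificate): `μ = 0` for the companion** (Greenberg's conjecture for an
irreducible residual representation, LNM 1716 Conj. 1.11; by Kim–Lee–Ponsinet Thm. 2.1 (1) ONE member of
the residual class with level prime to `3` suffices: residue MU = one bit per residual class — NOT uniform in
print). Nothing asserted. [cite: GreenbergLNM1716, Conj. 1.11 (μ = 0)] [cite: Kim2019KatoInvariants, Thm. 2.1 (1), Rem. 2.2] -/
@[conjecture] def CompanionMuZero : Prop :=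
  ∀ (W : WeierstrassCurve ℚ) [W.IsElliptic] (g : K.Form), K.IsCompanion W g → K.SUHyp g → K.MuZero g

/-- **K4a (descent, Iwasawa form, (G-ord) rows):** Kato-form main conjecture for `f_E` at the additive
potentially good ORDINARY prime `3` ⇒ the `T = 0` LOWER divisibility `CycLowerLeadingTermAt W 3` of the
Greenberg–Delbourgo characteristic ideal (Kato §17.13-type comparison for the twist + `ℓ_p(E) ∈ ℤ_p`).
Not printed as a statement at an additive `3` (u3-p1's lens; ROUTE-BK K4a). Nothing asserted.
[cite: Kato2004Asterisque, 17.13 (pp. 279–280)] [cite: Delbourgo2002, Theorem (A), (B) (p. 40)] -/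
@[conjecture] def DescentToCycLower [Fact (Nat.Prime 3)] : Prop :=
  ∀ (W : WeierstrassCurve ℚ) [W.IsElliptic] [W.IsGloballyMinimal],
    TypeGOrd W 3 → Addv W 3 → W.HasSurjectiveModNGaloisRep 3 → K.KMC (K.formOf W) →
      CycLowerLeadingTermAt W 3

/-- **K4a-(M) (descent, Iwasawa form, potentially MULTIPLICATIVE rows):** the same `T = 0` LOWER
divisibility on the (M)@3 rows (Delbourgo 1998 (M), Prop. 4 with §2.2 Lemma (ii): no CM / anomalous
binder there). ROUTE-BK §2 "the (M)@3 twin … one more def line". Nothing asserted.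
[cite: Delbourgo1998, Prop. 4 (p. 144), hypothesis (M) (p. 133), Main Conjecture (p. 151)] -/
@[conjecture] def DescentToCycLowerPotMult [Fact (Nat.Prime 3)] : Prop :=
  ∀ (W : WeierstrassCurve ℚ) [W.IsElliptic] [W.IsGloballyMinimal],
    PotMult W 3 → Addv W 3 → W.HasSurjectiveModNGaloisRep 3 → K.KMC (K.formOf W) →
      CycLowerLeadingTermAt W 3

/-- **K4b (descent, direct fine-Selmer form = O6's `LowerHalfRankZeroOfKMC` restricted):** KMC(f_E) ∧
`r_an = 0` ∧ 3-adic tower ⇒ `MissingLowerBoundAt W 3` (Kato 14.16 (2) + Kim AJM Lemma 3.9/3.10 + `T = 0`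
control of `H²_Iw`; not printed as a statement at an additive `3`: BSTW Thm. 2.12 proof "as observed by
Kato", Kim–Nakamura 2020 Rem. 1.8 (3)). Covers anomalous and `c₃ = 3` rows. On the unit rows it REDUCES to
the bridge `KMCGivesKuriharaUnitThree` + the PRE end state (§4). Nothing asserted.
[cite: Kato2004Asterisque, Prop. 14.16 (2) (p. 244), Thm. 14.5 (3) (p. 236)] [cite: KimNakamura2020, Rem. 1.8 (3)] -/
@[conjecture] def DescentDirect [Fact (Nat.Prime 3)] : Prop :=
  ∀ (W : WeierstrassCurve ℚ) [W.IsElliptic] [W.IsGloballyMinimal],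
    W.analyticRank = 0 → ClassX4 W 3 → (∀ n : ℕ, W.HasSurjectiveModNGaloisRep (3 ^ n : ℕ)) →
      K.KMC (K.formOf W) → MissingLowerBoundAt W 3

/-- **K4b-bridge (CONJ shell; the `p = 3` body of Kim AJM 148 Thm. 1.10 (3)⇒(1)):** on the tower rows with
analytic rank `0`, `3 ∤ ∏_ℓ c_ℓ`, `E(ℚ₃)[3] = 0` and an admissible₃ datum `D` (period transfer,
`Ω⁺_{D.f}`-integral plus symbols), `KMC(f_E)` gives a UNIT Kurihara number `X4.KuriharaUnitAt W 3 D.f`.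
Printed at `p ≥ 5` only (Kim AJM Thm. 1.10; arXiv v4 Thm. 1.11 p0008 L44–62); at `3` Kim–Pollack print
Thm. 3.18 (Λ-primitive ⟺ IMC) and Cor. 3.13–3.14 (primitive ⟺ `∂^{(∞)} = 0`) but not the specialisation
step nor the `κ ↦ δ̃` dictionary (tree flag `K22-Thm3.13-PORT@3`). Nothing asserted.
[cite: Kim2022StructureSelmer, Thm. 1.11 (arXiv v4, PDF p. 8)] [cite: Kim2025RefinedTNC, Thm. 3.18, Cor. 3.13–3.14 (ANNOUNCED)] -/
@[conjecture] def KMCGivesKuriharaUnitThree [Fact (Nat.Prime 3)] : Prop :=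
  ∀ (W : WeierstrassCurve ℚ) [W.IsElliptic] [W.IsGloballyMinimal],
    W.analyticRank = 0 → ClassX4 W 3 → (∀ n : ℕ, W.HasSurjectiveModNGaloisRep (3 ^ n : ℕ)) →
    ¬ 3 ∣ W.tamagawaProduct →
    Nat.card {Q : (W.baseChange ℚ_[3]).toAffine.Point // (3 : ℕ) • Q = 0} = 1 →
    ∀ {N : ℕ} [NeZero N] (D : ModularParametrizationData W N),
    (∃ u : ℚ, ‖(u : ℚ_[3])‖ = 1 ∧ W.realPeriodRat = u * plusPeriod D.f) →
    (∀ r : ℚ, ratPlusSymbol D.f r ≠ 0 → 0 ≤ padicValRat 3 (ratPlusSymbol D.f r)) →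
    K.KMC (K.formOf W) → X4.KuriharaUnitAt W 3 D.f

/-- **TARGET of the route on the (G-ord) split locus (socket S1, non-anomalous rows):** the LOWER half at `3`
for every N11 curve of type (G) at `3` whose mod-3 representation is split at `3`, non-CM, with non-anomalous
reduction of the ordinary twist. Open; nothing asserted. [cite: Miller2011LMS, Def. 1.1] -/
@[conjecture] def LowerHalfOnSplitLocus [Fact (Nat.Prime 3)] : Prop :=
  ∀ (W : WeierstrassCurve ℚ) [W.IsElliptic] [W.IsGloballyMinimal],
    W.analyticRank = 0 → ClassX4 W 3 → W.HasSurjectiveModNGaloisRep 3 → TypeGOrd W 3 →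
      K.SplitAtThree W → ¬ W.HasCM → Delbourgo2002.ReductionNonAnomalous W 3 → MissingLowerBoundAt W 3

/-- **TARGET of the route on the (M) split locus (socket S1M):** the LOWER half at `3` for every N11 curve
potentially multiplicative at `3` whose mod-3 representation is split at `3`. Open; nothing asserted.
[cite: Miller2011LMS, Def. 1.1] -/
@[conjecture] def LowerHalfOnSplitLocusPotMult [Fact (Nat.Prime 3)] : Prop :=
  ∀ (W : WeierstrassCurve ℚ) [W.IsElliptic] [W.IsGloballyMinimal],
    W.analyticRank = 0 → ClassX4 W 3 → W.HasSurjectiveModNGaloisRep 3 → PotMult W 3 →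
      K.SplitAtThree W → MissingLowerBoundAt W 3

/-! ### §3 Compositions (kernel-checked; every input an explicit binder) -/

/-- **Composition via the IW socket (S1): K1 + K2 + K2′ + K2″ + K3 + K4a + Delbourgo 2002 at `3`
(`hDel3`), GZK, modularity ⟹ the target on the (G-ord) split locus, non-anomalous rows.**
[cite: Delbourgo2002, Theorem (A), (B) (p. 40)] [cite: Miller2011LMS, Def. 1.1] -/
theorem lowerHalfOnSplitLocus_of [Fact (Nat.Prime 3)]
    (hDel3 : Delbourgo2002.mainTheorem_three)
    (hGZK : rank_eq_analyticRank_of_analyticRank_le_one) (hmod : hasEntireLFunction_rat)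
    (h1 : ResidualTransportAtThree K) (h2 : CompanionExistsOfSplit K) (h2' : CompanionSideConditions K)
    (h2'' : CompanionKMCOfSU K) (h3 : CompanionMuZero K) (h4 : DescentToCycLower K) :
    LowerHalfOnSplitLocus K := by
  intro W _ _ hr hX hsurj hG hsplit hcm hna
  obtain ⟨g, hg, hSU⟩ := h2' W hX hsurj (Or.inl hG) hsplit (h2 W hX hsurj (Or.inl hG) hsplit)
  have hE : K.KMC (K.formOf W) ∧ K.MuZero (K.formOf W) := h1 W g hg ⟨h2'' g hSU, h3 W g hg hSU⟩
  exact TypeGOrd.missingLowerBoundAt_three_rankZero_of_cycLower_of_nonAnomalous hDel3 hGZK hmod hG hX.2.1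
    hcm hr hna (h4 W hG hX.2.1 hsurj hE.1)

/-- **The non-CM binder is automatic on N11** (`ρ̄_{E,3}` onto ⇒ no CM; Zywina 2015, tree theorem
`WeierstrassCurve.not_hasSurjectiveModNGaloisRep_of_hasCM`): the target without the `¬ W.HasCM` binder.
[cite: Zywina2015, Prop. 1.14 / 1.16 (CM images are proper subgroups)] -/
theorem missingLowerBoundAt_three_gord_split_of [Fact (Nat.Prime 3)]
    (hDel3 : Delbourgo2002.mainTheorem_three)
    (hGZK : rank_eq_analyticRank_of_analyticRank_le_one) (hmod : hasEntireLFunction_rat)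
    (h1 : ResidualTransportAtThree K) (h2 : CompanionExistsOfSplit K) (h2' : CompanionSideConditions K)
    (h2'' : CompanionKMCOfSU K) (h3 : CompanionMuZero K) (h4 : DescentToCycLower K)
    (W : WeierstrassCurve ℚ) [W.IsElliptic] [W.IsGloballyMinimal]
    (hr : W.analyticRank = 0) (hX : ClassX4 W 3) (hsurj : W.HasSurjectiveModNGaloisRep 3)
    (hG : TypeGOrd W 3) (hsplit : K.SplitAtThree W) (hna : Delbourgo2002.ReductionNonAnomalous W 3) :
    MissingLowerBoundAt W 3 :=
  lowerHalfOnSplitLocus_of K hDel3 hGZK hmod h1 h2 h2' h2'' h3 h4 W hr hX hsurj hG hsplit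
    (fun hCM ↦ W.not_hasSurjectiveModNGaloisRep_of_hasCM hCM Nat.prime_three (by decide) hsurj) hna

/-- **Composition via the (M) socket (S1M): K1 + K2 + K2′ + K2″ + K3 + K4a-(M) + Delbourgo 1998 Prop. 4
on (M) (`hDelX`), GZK, modularity ⟹ the target on the potentially multiplicative split locus** (no CM /
anomalous binder on (M): `missingLowerBoundAt_rankZero_of_potMult_of_cycLeadingTermDvd`).
[cite: Delbourgo1998, Prop. 4 (p. 144), §2.2 Lemma (ii) (p. 139)] [cite: Miller2011LMS, Def. 1.1] -/
theorem lowerHalfOnSplitLocusPotMult_of [Fact (Nat.Prime 3)]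
    (hDelX : Delbourgo1998.prop4_rankZero_constantCoeff_eq_unit_mul_of_potMult)
    (hGZK : rank_eq_analyticRank_of_analyticRank_le_one) (hmod : hasEntireLFunction_rat)
    (h1 : ResidualTransportAtThree K) (h2 : CompanionExistsOfSplit K) (h2' : CompanionSideConditions K)
    (h2'' : CompanionKMCOfSU K) (h3 : CompanionMuZero K) (h4 : DescentToCycLowerPotMult K) :
    LowerHalfOnSplitLocusPotMult K := by
  intro W _ _ hr hX hsurj hM hsplit
  obtain ⟨g, hg, hSU⟩ := h2' W hX hsurj (Or.inr hM) hsplit (h2 W hX hsurj (Or.inr hM) hsplit)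
  have hE : K.KMC (K.formOf W) ∧ K.MuZero (K.formOf W) := h1 W g hg ⟨h2'' g hSU, h3 W g hg hSU⟩
  have hLow : CycLowerLeadingTermAt W 3 := h4 W hM hX.2.1 hsurj hE.1
  exact missingLowerBoundAt_rankZero_of_potMult_of_cycLeadingTermDvd W 3 hDelX hGZK hmod (by decide)
    hX.2.1 hM hr ((cycLeadingTermDvdAt_iff_cycLowerLeadingTermAt W 3).mpr hLow)

/-- **Composition via the direct descent K4b (all split tower rows, anomalous and `c₃ = 3` included):**
K1 + K2 + K2′ + K2″ + K3 + K4b ⟹ `MissingLowerBoundAt W 3`. [cite: Miller2011LMS, Def. 1.1] -/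
theorem missingLowerBoundAt_three_of_companion_direct [Fact (Nat.Prime 3)]
    (h1 : ResidualTransportAtThree K) (h2 : CompanionExistsOfSplit K) (h2' : CompanionSideConditions K)
    (h2'' : CompanionKMCOfSU K) (h3 : CompanionMuZero K) (h4 : DescentDirect K)
    (W : WeierstrassCurve ℚ) [W.IsElliptic] [W.IsGloballyMinimal]
    (hr : W.analyticRank = 0) (hX : ClassX4 W 3) (htower : ∀ n : ℕ, W.HasSurjectiveModNGaloisRep (3 ^ n : ℕ))
    (hord : TypeGOrd W 3 ∨ PotMult W 3) (hsplit : K.SplitAtThree W) : MissingLowerBoundAt W 3 := by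
  have hsurj : W.HasSurjectiveModNGaloisRep 3 := by simpa using htower 1
  obtain ⟨g, hg, hSU⟩ := h2' W hX hsurj hord hsplit (h2 W hX hsurj hord hsplit)
  exact h4 W hr hX htower (h1 W g hg ⟨h2'' g hSU, h3 W g hg hSU⟩).1

/-! ### §4 K4b on the unit rows from the bridge and the PRE end state (no K4 conjecture left there) -/

/-- **K4b REDUCED on the unit rows:** the bridge shell (`hK4`: KMC(f_E) ⇒ unit Kurihara number, the
`p = 3` body of Kim Thm. 1.10) and the announced structure clause (`hK25s`, PRE, flag `Kim2025-preprint`)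
give the K4b descent on the tower rows with `3 ∤ ∏c`, `E(ℚ₃)[3] = 0` and an admissible₃ datum:
`KMC(f_E) ⟹ MissingLowerBoundAt W 3` (∂^{(∞)} = 0 ⇒ the `≤` half of Conj. 1.10 trivially ⇒ the end state
`missingLowerBoundAt_iff_kimTamagawaDefectLeAt_of_kim2025_OPEN`). [claim: Kim2025RefinedTNC, status: under-review]
[cite: Kim2022StructureSelmer, Thm. 1.11 and Conj. 1.10 (arXiv v4, PDF p. 8)] [cite: Miller2011LMS, Def. 1.1] -/
theorem missingLowerBoundAt_three_of_kmc_of_bridge [Fact (Nat.Prime 3)]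
    (hK4 : KMCGivesKuriharaUnitThree K)
    (hK25s : Kim2025.thm11_kimShaLength_of_integralPeriod_OPEN)
    (hGZK : rank_eq_analyticRank_of_analyticRank_le_one) (hmod : hasEntireLFunction_rat)
    (W : WeierstrassCurve ℚ) [W.IsElliptic] [W.IsGloballyMinimal]
    (hr : W.analyticRank = 0) (hX : ClassX4 W 3)
    (htower : ∀ n : ℕ, W.HasSurjectiveModNGaloisRep (3 ^ n : ℕ))
    (htam : ¬ 3 ∣ W.tamagawaProduct)
    (ht0 : Nat.card {Q : (W.baseChange ℚ_[3]).toAffine.Point // (3 : ℕ) • Q = 0} = 1)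
    {N : ℕ} [NeZero N] (D : ModularParametrizationData W N)
    (hper : ∃ u : ℚ, ‖(u : ℚ_[3])‖ = 1 ∧ W.realPeriodRat = u * plusPeriod D.f)
    (hint : ∀ r : ℚ, ratPlusSymbol D.f r ≠ 0 → 0 ≤ padicValRat 3 (ratPlusSymbol D.f r))
    (hKMC : K.KMC (K.formOf W)) : MissingLowerBoundAt W 3 := by
  have hunit : X4.KuriharaUnitAt W 3 D.f := hK4 W hr hX htower htam ht0 D hper hint hKMC
  have h0 : kuriharaPartialInfty W 3 D.f = 0 :=
    (X4.kuriharaUnitAt_iff_kuriharaPartialInfty_eq_zero W 3 D.f).mp hunit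
  have hle : X4.KimTamagawaDefectLeAt W 3 D.f := by
    show kuriharaPartialInfty W 3 D.f ≤ (padicValNat 3 W.tamagawaProduct : ℕ∞)
    rw [h0]; exact zero_le
  exact (missingLowerBoundAt_iff_kimTamagawaDefectLeAt_of_kim2025_OPEN W 3 hK25s hGZK hmod le_rfl hr
    htower D hper hint).mpr hle

/-- **END-TO-END on S-SPLIT ∩ unit rows ∩ admissible datum, with NO K4 conjecture:** K1 + K2 + K2′ + K2″
+ K3 + the bridge + the PRE clause ⟹ `MissingLowerBoundAt W 3`. The named non-printed inputs are exactly
K1 (transport at level `9M`), K3 (the `μ`-bit) and the bridge; everything else is PUB / PUB* / PRE /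
kernel. [claim: Kim2025RefinedTNC, status: under-review] [cite: Miller2011LMS, Def. 1.1] -/
theorem missingLowerBoundAt_three_of_companion_of_bridge [Fact (Nat.Prime 3)]
    (h1 : ResidualTransportAtThree K) (h2 : CompanionExistsOfSplit K) (h2' : CompanionSideConditions K)
    (h2'' : CompanionKMCOfSU K) (h3 : CompanionMuZero K) (hK4 : KMCGivesKuriharaUnitThree K)
    (hK25s : Kim2025.thm11_kimShaLength_of_integralPeriod_OPEN)
    (hGZK : rank_eq_analyticRank_of_analyticRank_le_one) (hmod : hasEntireLFunction_rat)
    (W : WeierstrassCurve ℚ) [W.IsElliptic] [W.IsGloballyMinimal]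
    (hr : W.analyticRank = 0) (hX : ClassX4 W 3)
    (htower : ∀ n : ℕ, W.HasSurjectiveModNGaloisRep (3 ^ n : ℕ))
    (hord : TypeGOrd W 3 ∨ PotMult W 3) (hsplit : K.SplitAtThree W)
    (htam : ¬ 3 ∣ W.tamagawaProduct)
    (ht0 : Nat.card {Q : (W.baseChange ℚ_[3]).toAffine.Point // (3 : ℕ) • Q = 0} = 1)
    {N : ℕ} [NeZero N] (D : ModularParametrizationData W N)
    (hper : ∃ u : ℚ, ‖(u : ℚ_[3])‖ = 1 ∧ W.realPeriodRat = u * plusPeriod D.f)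
    (hint : ∀ r : ℚ, ratPlusSymbol D.f r ≠ 0 → 0 ≤ padicValRat 3 (ratPlusSymbol D.f r)) :
    MissingLowerBoundAt W 3 := by
  have hsurj : W.HasSurjectiveModNGaloisRep 3 := by simpa using htower 1
  obtain ⟨g, hg, hSU⟩ := h2' W hX hsurj hord hsplit (h2 W hX hsurj hord hsplit)
  have hKMC : K.KMC (K.formOf W) := (h1 W g hg ⟨h2'' g hSU, h3 W g hg hSU⟩).1
  exact missingLowerBoundAt_three_of_kmc_of_bridge K hK4 hK25s hGZK hmod W hr hX htower htam ht0 D hper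
    hint hKMC

end Summit.BirchSwinnertonDyer.Uniform.U3.RouteBK

end
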